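import Summits.QuantumFields.YangMills.Theorems.BalabanUVNodesN15CovariantTwoGridCellOscillation
import Summits.QuantumFields.YangMills.Theorems.BalabanUVNodesN15PerCubeGreenTwoGridSiteFits
import Summits.QuantumFields.YangMills.Theorems.BalabanUVNodesN15PerCubeGreenFineRows
import Summits.QuantumFields.YangMills.Theorems.BalabanUVNodesN15CovariantAveragingHolonomyFit
import HarnessLib

/-!
# N15 = NE2, road (c) — PROGRAMME (PC) «[B9] Sect. C FOR THE LANDAU LETTER WITH PER-CUBE GAUGES (3.35) AS PRINTED», (PC-E) (C6-e) (G4): THE SITE GEOMETRY OF KING's PAIRING FOR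
# THE CLOSING ASSEMBLY — which fine sites the two-grid fits touch, measured in UNIT BLOCKS from the plateau of the cube: the fine lines over a coarse bond stay within one block of
# it, one fine ∕ coarse step moves the unit block by at most one, so every site the letters of n15-c∕340–345 are evaluated at lies within THREE blocks of the plateau `𝔅_k`, and
# the (3.35) cube `Q_k ⊇ {z : dist(B′(z), 𝔅_k) ≤ 5}` carries them all with the two-step collar the step letters need; plus the OSCILLATION row `hΩ` of n15-c∕343∕344 from the
# all-direction step letter (n15-c∕345 fibre walks, localized by block distance) (dag-n15-c g32, n15-c∕347)

Cell `pub-ymgap`, seat `pub-ymgap-dag-n15-c` (generation g32; R134 (a) seat, strategy s1 «first missing estimate»; HUMAN RULING D-0062; chair R424 venue).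
`bears_on: R4∕N15 · K3⁸ SpineGivenEndpointR13SepCoPHV (stmt-QuantumFields-27366)`; filed `--kind proof --supports stmt-QuantumFields-27366 --as helper` — COUNT-NEUTRAL.
THEOREMS only ([folklore] lattice geometry), 0 `def`, 0 `sorry`.  Imports BY NAME n15-c∕345 `…CovariantTwoGridCellOscillation` (`norm_cellOsc_le`, `norm_cellOsc_back_le`), dag-n15-a∕n15-c
`…PerCubeGreenTwoGridSiteFits` (`scBlk_mem_cvSk_of_scChi_ne_zero`), n15-c `…PerCubeGreenFineRows` (`tdistT_scBlk'_scShift'_le`), `…PerCubeGreenRows` (`tdistT_scBlk_scShift_le`),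
n15-c∕183 `…CovariantAveragingHolonomyFit` (`kingPr_add_smul_of_dvd`); through them `blockOf_kingPr`, `kingPr_kingSec`, `kingSec_val`, `kingSec_sub_unitVec`, King1986 `tdistT_triangle`.
Nothing in the tree is modified, no landed name re-declared.

WHY.  n15-c∕340 `uN_idef_scGreen_tr` takes the (3.35) letters on abstract site sets `Qf k` (fine) and `Qc k` (coarse) with membership rows `hQf`∕`hQρ`∕`hQc`; n15-c∕341∕343∕344 evaluate
the fine letters on the fine LINES `σx + te′_μ − se′_μ` over coarse bonds near the cut box and n15-c∕345 on the King CELLS there; n15-c∕346 produces the letters from ONE (3.35) datum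
per cube on a set `Q` provided the site and its one- and two-step translates lie in `Q`.  This file measures all these sites by the block distance `dist(B′(z), 𝔅_k)` to the plateau:
(G1) one step moves the block by `≤ 1` (both orientations, both grids); (G2) ★ the fine line over the bond at `x` stays within one block of `B(x)` (`π(σx + te′ − se′) ∈ {x, x − e_μ}`);
(G3) ★ block distance `≤ 3` from `𝔅_k` puts the site together with its two-step collar inside any `Q ⊇ {dist ≤ 5}`; (G4) ★★ `sc_hΩ_of_stepLetters`: the oscillation row `hΩ` of
n15-c∕343∕344 LITERALLY, with `Ω = ((d+1)(L^r−1) + L^r + 1)·b`, from an all-direction step letter `b` at every fine site within three blocks of `𝔅_k` (n15-c∕345's two fibre-walk lemmas;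
the cells of `πx′` and `πx′ − e_μ` and the backward step at `x′` are within one block of `B(πx′) ∈ 𝔅_k` for `πx′` in the cut box).

HONEST FRAMING ∕ LIMITS.  Elementary lattice geometry on the (PC) site carriers; MODEL pairing (straight holonomy); nothing of [B7]∕[B9] asserted ((3.35) p.396 = SHAPE).  NE2⁺ NOT PRINTED,
NOT proved; N15 of record untouched (DISCHARGED AS CONSUMED, p687738); K3⁸ OPEN; counts of record UNMOVED (typed 28∕28 · discharged 8∕27); one finite 𝕋⁴ at fixed ε per index — NOT
infinite volume, NOT OS on ℝ⁴, NOT a mass gap, NOT Clay.  Restate-immune (no Theses import).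
-/

set_option autoImplicit false

noncomputable section

open scoped BigOperators Matrix Matrix.Norms.L2Operator
open Finset

namespace Summit.QuantumFields.YangMills.BalabanUVNodes.N15.Gluing

open Literature.MathematicalPhysics.QuantumFieldTheory.Balaban1983to89
open Literature.MathematicalPhysics.QuantumFieldTheory.Balaban1983to89.B5Prop11Plancherel (Tor fine unitVec)
open Literature.MathematicalPhysics.QuantumFieldTheory.Balaban1983to89.B6UnitTorusCarrier (unitTorusGeo)
open Literature.MathematicalPhysics.QuantumFieldTheory.King1986.Torus (blockOf tdistT_triangle tdistT_symm tdistT_self)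
open Summit.QuantumFields.YangMills.BalabanUVNodes.N15.VectorPiece (kingPr)
open Summit.QuantumFields.YangMills.BalabanUVNodes.N15.CovAvg (kingSec kingPr_add_smul_of_dvd kingPr_kingSec kingSec_val kingSec_sub_unitVec norm_cellOsc_le norm_cellOsc_back_le)

variable {d : ℕ} {L : ℕ} [NeZero L] {mv kk r : ℕ} {hL : Odd L ∧ 1 < L}

/-! ## (G1) One step moves the unit block by at most one (backward orientations) -/

/-- `dist(B′(z − e′_κ), B′(z)) ≤ 1`. [folklore] -/
theorem tdist_scBlk'_scShift'_symm_le (κ : Fin (d + 1)) (z : ScX' d L mv kk r hL) :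
    (unitTorusGeo L kk (cvM d L mv kk hL)).dist (scBlk' d L mv kk r hL ((scShift' d L mv kk r hL κ).symm z)) (scBlk' d L mv kk r hL z) ≤ 1 := by
  have h := tdistT_scBlk'_scShift'_le (d := d) (L := L) (mv := mv) (kk := kk) (r := r) (hL := hL) κ ((scShift' d L mv kk r hL κ).symm z)
  rw [Equiv.apply_symm_apply] at h
  exact (tdistT_symm _ _ _).trans_le h

/-- `dist(B(x − e_κ), B(x)) ≤ 1`. [folklore] -/
theorem tdist_scBlk_scShift_symm_le (κ : Fin (d + 1)) (x : ScX d L mv kk hL) :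
    (unitTorusGeo L kk (cvM d L mv kk hL)).dist (scBlk d L mv kk hL ((scShift d L mv kk hL κ).symm x)) (scBlk d L mv kk hL x) ≤ 1 := by
  have h := tdistT_scBlk_scShift_le (d := d) (L := L) (mv := mv) (kk := kk) (hL := hL) κ ((scShift d L mv kk hL κ).symm x)
  rw [Equiv.apply_symm_apply] at h
  exact (tdistT_symm _ _ _).trans_le h

omit [NeZero L] in
/-- `(scShift μ)⁻¹ y = y − e_μ`. [folklore] -/
theorem scShift_symm_eq_sub (μ : Fin (d + 1)) (y : ScX d L mv kk hL) : (scShift d L mv kk hL μ).symm y = y - unitVec (fine (L ^ kk) (cvM d L mv kk hL)) μ := by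
  show (Equiv.addRight _).symm y = _; rw [Equiv.addRight_symm]; show y + -_ = _; rw [← sub_eq_add_neg]

omit [NeZero L] in
/-- `(scShift′ μ)⁻¹ z = z − e′_μ`. [folklore] -/
theorem scShift'_symm_eq_sub (μ : Fin (d + 1)) (z : ScX' d L mv kk r hL) : (scShift' d L mv kk r hL μ).symm z = z - unitVec (fine (L ^ r * L ^ kk) (cvM d L mv kk hL)) μ := by
  show (Equiv.addRight _).symm z = _; rw [Equiv.addRight_symm]; show z + -_ = _; rw [← sub_eq_add_neg]

omit [NeZero L] in
/-- distance bookkeeping: a block within `1` of a block within `a` of the set `B` is within `a + 1` of `B`. [folklore] -/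
theorem exists_tdist_le_succ {B : Set (Tor (cvM d L mv kk hL))} {b b' : Tor (cvM d L mv kk hL)} {a : ℝ} (h : (unitTorusGeo L kk (cvM d L mv kk hL)).dist b' b ≤ 1) (hb : ∃ y ∈ B, (unitTorusGeo L kk (cvM d L mv kk hL)).dist b y ≤ a) :
    ∃ y ∈ B, (unitTorusGeo L kk (cvM d L mv kk hL)).dist b' y ≤ a + 1 := by
  obtain ⟨y, hy, hd⟩ := hb
  exact ⟨y, hy, (tdistT_triangle _ _ _ _).trans (by linarith)⟩

/-! ## (G2) The fine line over a coarse bond stays within one block of it -/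

/-- ★ for `t < L^r`, `s ≤ L^r`: `dist(B′(σx + te′_μ − se′_μ), B(x)) ≤ 1` — the site projects under King's `π` to `x` (`s ≤ t`) or to `x − e_μ` (`t < s`). [cite: King1986, p.664 (pairing
convention)] -/
theorem tdist_scBlk'_line_le (μ : Fin (d + 1)) (x : ScX d L mv kk hL) {t s : ℕ} (ht : t < L ^ r) (hs : s ≤ L ^ r) :
    (unitTorusGeo L kk (cvM d L mv kk hL)).dist (scBlk' d L mv kk r hL (kingSec (cvM d L mv kk hL) L kk r x + t • unitVec (fine (L ^ r * L ^ kk) (cvM d L mv kk hL)) μ - s • unitVec (fine (L ^ r * L ^ kk) (cvM d L mv kk hL)) μ)) (scBlk d L mv kk hL x) ≤ 1 := by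
  have hLr : 0 < L ^ r := pow_pos (Nat.pos_of_ne_zero (NeZero.ne L)) r
  by_cases hst : s ≤ t
  · -- `σx + (t − s)e′` projects to `x`
    have e1 : kingSec (cvM d L mv kk hL) L kk r x + t • unitVec (fine (L ^ r * L ^ kk) (cvM d L mv kk hL)) μ - s • unitVec (fine (L ^ r * L ^ kk) (cvM d L mv kk hL)) μ = kingSec (cvM d L mv kk hL) L kk r x + (t - s) • unitVec (fine (L ^ r * L ^ kk) (cvM d L mv kk hL)) μ := by
      rw [sub_eq_iff_eq_add, add_assoc, ← add_nsmul, Nat.sub_add_cancel hst]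
    have hdvd : L ^ r ∣ (kingSec (cvM d L mv kk hL) L kk r x μ).val := by rw [kingSec_val]; exact dvd_mul_right _ _
    have e2 : kingPr L kk r (cvM d L mv kk hL) (kingSec (cvM d L mv kk hL) L kk r x + (t - s) • unitVec (fine (L ^ r * L ^ kk) (cvM d L mv kk hL)) μ) = x := by
      rw [kingPr_add_smul_of_dvd (hx := hdvd), kingPr_kingSec, Nat.div_eq_of_lt (by omega), zero_smul, add_zero]
    have e3 : scBlk' d L mv kk r hL (kingSec (cvM d L mv kk hL) L kk r x + t • unitVec (fine (L ^ r * L ^ kk) (cvM d L mv kk hL)) μ - s • unitVec (fine (L ^ r * L ^ kk) (cvM d L mv kk hL)) μ) = scBlk d L mv kk hL x := by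
      rw [e1]; show blockOf _ _ _ = blockOf _ _ _; rw [← CovAvg.blockOf_kingPr, e2]
    rw [e3]; exact (le_of_eq (tdistT_self _ _)).trans zero_le_one
  · -- `σ(x − e_μ) + (L^r + t − s)e′` projects to `x − e_μ`
    have hts : t < s := lt_of_not_ge hst
    have e1 : kingSec (cvM d L mv kk hL) L kk r x + t • unitVec (fine (L ^ r * L ^ kk) (cvM d L mv kk hL)) μ - s • unitVec (fine (L ^ r * L ^ kk) (cvM d L mv kk hL)) μ = kingSec (cvM d L mv kk hL) L kk r (x - unitVec (fine (L ^ kk) (cvM d L mv kk hL)) μ) + (L ^ r + t - s) • unitVec (fine (L ^ r * L ^ kk) (cvM d L mv kk hL)) μ := by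
      rw [kingSec_sub_unitVec]
      have hn : (L ^ r + t - s) • unitVec (fine (L ^ r * L ^ kk) (cvM d L mv kk hL)) μ + s • unitVec (fine (L ^ r * L ^ kk) (cvM d L mv kk hL)) μ = (L ^ r) • unitVec (fine (L ^ r * L ^ kk) (cvM d L mv kk hL)) μ + t • unitVec (fine (L ^ r * L ^ kk) (cvM d L mv kk hL)) μ := by
        rw [← add_nsmul, ← add_nsmul, Nat.sub_add_cancel (by omega)]
      rw [eq_sub_of_add_eq hn]; abel
    have hdvd : L ^ r ∣ (kingSec (cvM d L mv kk hL) L kk r (x - unitVec (fine (L ^ kk) (cvM d L mv kk hL)) μ) μ).val := by rw [kingSec_val]; exact dvd_mul_right _ _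
    have e2 : kingPr L kk r (cvM d L mv kk hL) (kingSec (cvM d L mv kk hL) L kk r (x - unitVec (fine (L ^ kk) (cvM d L mv kk hL)) μ) + (L ^ r + t - s) • unitVec (fine (L ^ r * L ^ kk) (cvM d L mv kk hL)) μ) = x - unitVec (fine (L ^ kk) (cvM d L mv kk hL)) μ := by
      rw [kingPr_add_smul_of_dvd (hx := hdvd), kingPr_kingSec, Nat.div_eq_of_lt (by omega), zero_smul, add_zero]
    have e3 : scBlk' d L mv kk r hL (kingSec (cvM d L mv kk hL) L kk r x + t • unitVec (fine (L ^ r * L ^ kk) (cvM d L mv kk hL)) μ - s • unitVec (fine (L ^ r * L ^ kk) (cvM d L mv kk hL)) μ) = scBlk d L mv kk hL (x - unitVec (fine (L ^ kk) (cvM d L mv kk hL)) μ) := by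
      rw [e1]; show blockOf _ _ _ = blockOf _ _ _; rw [← CovAvg.blockOf_kingPr, e2]
    rw [e3]
    have h := tdistT_scBlk_scShift_le (d := d) (L := L) (mv := mv) (kk := kk) (hL := hL) μ (x - unitVec (fine (L ^ kk) (cvM d L mv kk hL)) μ)
    have e4 : scShift d L mv kk hL μ (x - unitVec (fine (L ^ kk) (cvM d L mv kk hL)) μ) = x := sub_add_cancel _ _
    rw [e4] at h
    exact (tdistT_symm _ _ _).trans_le h

/-! ## (G3) Block distance three from the plateau puts the site and its two-step collar inside `Q ⊇ {dist ≤ 5}` -/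

/-- ★ if `Q` contains every fine site whose unit block is within `5` of the block set `B`, then a site within `3` of `B` lies in `Q` together with `z ± e′_κ` and `z ± e′_κ + e′_μ`.
[folklore] -/
theorem sc_collar_mem {B : Set (Tor (cvM d L mv kk hL))} {Q : Set (ScX' d L mv kk r hL)} (hQ : ∀ z, (∃ y ∈ B, (unitTorusGeo L kk (cvM d L mv kk hL)).dist (scBlk' d L mv kk r hL z) y ≤ 5) → z ∈ Q) (z : ScX' d L mv kk r hL)
    (hz : ∃ y ∈ B, (unitTorusGeo L kk (cvM d L mv kk hL)).dist (scBlk' d L mv kk r hL z) y ≤ 3) :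
    z ∈ Q ∧ ∀ κ, scShift' d L mv kk r hL κ z ∈ Q ∧ (scShift' d L mv kk r hL κ).symm z ∈ Q ∧
      ∀ μ, scShift' d L mv kk r hL μ (scShift' d L mv kk r hL κ z) ∈ Q ∧ scShift' d L mv kk r hL μ ((scShift' d L mv kk r hL κ).symm z) ∈ Q := by
  have up : ∀ w : ScX' d L mv kk r hL, ∀ a : ℝ, (∃ y ∈ B, (unitTorusGeo L kk (cvM d L mv kk hL)).dist (scBlk' d L mv kk r hL w) y ≤ a) → ∀ κ, (∃ y ∈ B, (unitTorusGeo L kk (cvM d L mv kk hL)).dist (scBlk' d L mv kk r hL (scShift' d L mv kk r hL κ w)) y ≤ a + 1) ∧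
      (∃ y ∈ B, (unitTorusGeo L kk (cvM d L mv kk hL)).dist (scBlk' d L mv kk r hL ((scShift' d L mv kk r hL κ).symm w)) y ≤ a + 1) := fun w a hw κ =>
    ⟨exists_tdist_le_succ (tdistT_scBlk'_scShift'_le κ w) hw, exists_tdist_le_succ (tdist_scBlk'_scShift'_symm_le κ w) hw⟩
  have mono : ∀ w : ScX' d L mv kk r hL, ∀ a : ℝ, a ≤ 5 → (∃ y ∈ B, (unitTorusGeo L kk (cvM d L mv kk hL)).dist (scBlk' d L mv kk r hL w) y ≤ a) → w ∈ Q := fun w a ha hw => by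
    obtain ⟨y, hy, hd⟩ := hw; exact hQ w ⟨y, hy, hd.trans ha⟩
  refine ⟨mono z 3 (by norm_num) hz, fun κ => ⟨mono _ (3 + 1) (by norm_num) (up z 3 hz κ).1, mono _ (3 + 1) (by norm_num) (up z 3 hz κ).2, fun μ =>
    ⟨mono _ (3 + 1 + 1) (by norm_num) (up _ (3 + 1) (up z 3 hz κ).1 μ).1, mono _ (3 + 1 + 1) (by norm_num) (up _ (3 + 1) (up z 3 hz κ).2 μ).1⟩⟩⟩

/-! ## (G4) The oscillation row `hΩ` of n15-c∕343∕344 from the all-direction step letter -/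

section Osc

variable (hM : ∀ ν, cvM d L mv kk hL ν = 2 * L * L ^ mv) (hm₁ : 2 * L ^ mv ≤ coverMargin L mv) (hfitI : coverMargin L mv - 2 * L ^ mv + (6 * L ^ mv + 1) ≤ L * L ^ mv)
  (hS0 : L * L ^ mv ≤ 2 * L * L ^ mv)

include hM hm₁ hfitI hS0 in
/-- for `πx′` in the cut box of `k`: every fine site of the King cell of `x′` is within `0`, every site of the cell of `πx′ − e_μ` and the site `x′ − e′_μ` within `1`, of the
plateau `𝔅_k` (block distance). [cite: King1986, p.664 (pairing convention)] -/
theorem sc_cell_tdist_le (k : Fin (d + 1) → ZMod (2 * L)) (μ : Fin (d + 1)) (x' : ScX' d L mv kk r hL) (hχ : scChi d L mv kk hL k (kingPr L kk r (cvM d L mv kk hL) x') ≠ 0) :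
    (∀ z : ScX' d L mv kk r hL, kingPr L kk r (cvM d L mv kk hL) z = kingPr L kk r (cvM d L mv kk hL) x' → ∃ y ∈ cvSk d L mv kk hL k, (unitTorusGeo L kk (cvM d L mv kk hL)).dist (scBlk' d L mv kk r hL z) y ≤ 3) ∧
    (∀ z : ScX' d L mv kk r hL, kingPr L kk r (cvM d L mv kk hL) z = kingPr L kk r (cvM d L mv kk hL) x' - unitVec (fine (L ^ kk) (cvM d L mv kk hL)) μ → ∃ y ∈ cvSk d L mv kk hL k, (unitTorusGeo L kk (cvM d L mv kk hL)).dist (scBlk' d L mv kk r hL z) y ≤ 3) ∧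
    (∃ y ∈ cvSk d L mv kk hL k, (unitTorusGeo L kk (cvM d L mv kk hL)).dist (scBlk' d L mv kk r hL (x' - unitVec (fine (L ^ r * L ^ kk) (cvM d L mv kk hL)) μ)) y ≤ 3) := by
  have hB : scBlk d L mv kk hL (kingPr L kk r (cvM d L mv kk hL) x') ∈ cvSk d L mv kk hL k := scBlk_mem_cvSk_of_scChi_ne_zero hM hm₁ hfitI hS0 hχ
  have hblk : ∀ z : ScX' d L mv kk r hL, scBlk' d L mv kk r hL z = scBlk d L mv kk hL (kingPr L kk r (cvM d L mv kk hL) z) := fun z => (CovAvg.blockOf_kingPr (L := L) (k := kk) (m := r) (M := cvM d L mv kk hL) z).symm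
  refine ⟨fun z hz => ⟨_, hB, ?_⟩, fun z hz => ⟨_, hB, ?_⟩, ⟨_, hB, ?_⟩⟩
  · rw [hblk z, hz]; exact (le_of_eq (tdistT_self _ _)).trans (by norm_num)
  · rw [hblk z, hz]
    have h := tdist_scBlk_scShift_symm_le (d := d) (L := L) (mv := mv) (kk := kk) (hL := hL) μ (kingPr L kk r (cvM d L mv kk hL) x')
    rw [scShift_symm_eq_sub] at h; linarith
  · have h := tdist_scBlk'_scShift'_symm_le (d := d) (L := L) (mv := mv) (kk := kk) (r := r) (hL := hL) μ x'
    rw [scShift'_symm_eq_sub, hblk x'] at h; linarith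

include hM hm₁ hfitI hS0 in
/-- ★★ THE OSCILLATION ROW `hΩ` of n15-c∕343 `sc_hfitA_of_pairing` ∕ n15-c∕344 `sc_hfitC_of_pairing` LITERALLY, with `Ω = ((d+1)(L^r−1) + L^r + 1)·b`, from an all-direction step letter
`‖V′_μ(z + e′_κ) − V′_μ(z)‖ ≤ b` at every fine site within three blocks of the plateau `𝔅_k` (n15-c∕345 `norm_cellOsc_le` ∕ `norm_cellOsc_back_le` on the cells of `πx′` and
`πx′ − e_μ`). [cite: King1986, p.664 (pairing convention); Balaban1985Averaging, (125) p.36 (staircase: shape)] -/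
theorem sc_hΩ_of_stepLetters {mm : Type} [Fintype mm] [DecidableEq mm] (u' : (Fin (d + 1) → ZMod (2 * L)) → ScX' d L mv kk r hL → Matrix mm mm ℂ) (U' : Fin (d + 1) → ScX' d L mv kk r hL → Matrix mm mm ℂ)
    {b : ℝ} (hb : 0 ≤ b)
    (hstep : ∀ k κ μ (z : ScX' d L mv kk r hL), (∃ y ∈ cvSk d L mv kk hL k, (unitTorusGeo L kk (cvM d L mv kk hL)).dist (scBlk' d L mv kk r hL z) y ≤ 3) →
      ‖u' k (z + unitVec (fine (L ^ r * L ^ kk) (cvM d L mv kk hL)) κ) * U' μ (z + unitVec (fine (L ^ r * L ^ kk) (cvM d L mv kk hL)) κ) * (u' k ((z + unitVec (fine (L ^ r * L ^ kk) (cvM d L mv kk hL)) κ) + unitVec (fine (L ^ r * L ^ kk) (cvM d L mv kk hL)) μ))ᴴ - (u' k z * U' μ z * (u' k (z + unitVec (fine (L ^ r * L ^ kk) (cvM d L mv kk hL)) μ))ᴴ)‖ ≤ b) :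
    ∀ k μ x', scChi d L mv kk hL k (kingPr L kk r (cvM d L mv kk hL) x') ≠ 0 → ∀ t < L ^ r, ‖u' k x' * U' μ x' * (u' k (scShift' d L mv kk r hL μ x'))ᴴ - (u' k (kingSec (cvM d L mv kk hL) L kk r (kingPr L kk r (cvM d L mv kk hL) x') + t • unitVec (fine (L ^ r * L ^ kk) (cvM d L mv kk hL)) μ) * U' μ (kingSec (cvM d L mv kk hL) L kk r (kingPr L kk r (cvM d L mv kk hL) x') + t • unitVec (fine (L ^ r * L ^ kk) (cvM d L mv kk hL)) μ) * (u' k (kingSec (cvM d L mv kk hL) L kk r (kingPr L kk r (cvM d L mv kk hL) x') + t • unitVec (fine (L ^ r * L ^ kk) (cvM d L mv kk hL)) μ + unitVec (fine (L ^ r * L ^ kk) (cvM d L mv kk hL)) μ))ᴴ)‖ ≤ ((((d + 1 : ℕ) : ℝ) * ((L ^ r - 1 : ℕ) : ℝ) + (L ^ r : ℕ) + 1) * b) ∧ ‖u' k ((scShift' d L mv kk r hL μ).symm x') * U' μ ((scShift' d L mv kk r hL μ).symm x') * (u' k (scShift' d L mv kk r hL μ ((scShift' d L mv kk r hL μ).symm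 x')))ᴴ - (u' k (kingSec (cvM d L mv kk hL) L kk r ((scShift d L mv kk hL μ).symm (kingPr L kk r (cvM d L mv kk hL) x')) + t • unitVec (fine (L ^ r * L ^ kk) (cvM d L mv kk hL)) μ) * U' μ (kingSec (cvM d L mv kk hL) L kk r ((scShift d L mv kk hL μ).symm (kingPr L kk r (cvM d L mv kk hL) x')) + t • unitVec (fine (L ^ r * L ^ kk) (cvM d L mv kk hL)) μ) * (u' k (kingSec (cvM d L mv kk hL) L kk r ((scShift d L mv kk hL μ).symm (kingPr L kk r (cvM d L mv kk hL) x')) + t • unitVec (fine (L ^ r * L ^ kk) (cvM d L mv kk hL)) μ + unitVec (fine (L ^ r * L ^ kk) (cvM d L mv kk hL)) μ))ᴴ)‖ ≤ ((((d + 1 : ℕ) : ℝ) * ((L ^ r - 1 : ℕ) : ℝ) + (L ^ r : ℕ) + 1) * b) := by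
  intro k μ x' hχ t ht
  obtain ⟨hc0, hc1, hbk⟩ := sc_cell_tdist_le hM hm₁ hfitI hS0 k μ x' hχ
  have hΩ1 : (((d + 1 : ℕ) : ℝ) * ((L ^ r - 1 : ℕ) : ℝ) + (L ^ r : ℕ)) * b ≤ ((((d + 1 : ℕ) : ℝ) * ((L ^ r - 1 : ℕ) : ℝ) + (L ^ r : ℕ) + 1) * b) := mul_le_mul_of_nonneg_right (by linarith) hb
  set f : ScX' d L mv kk r hL → Matrix mm mm ℂ := fun z => u' k z * U' μ z * (u' k (z + unitVec (fine (L ^ r * L ^ kk) (cvM d L mv kk hL)) μ))ᴴ with hf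
  have hst : ∀ (i : Fin (d + 1)) (z : ScX' d L mv kk r hL), kingPr L kk r (cvM d L mv kk hL) z = kingPr L kk r (cvM d L mv kk hL) x' → ‖f (z + unitVec (fine (L ^ r * L ^ kk) (cvM d L mv kk hL)) i) - f z‖ ≤ b := fun i z hz => hstep k i μ z (hc0 z hz)
  have hst' : ∀ z : ScX' d L mv kk r hL, kingPr L kk r (cvM d L mv kk hL) z = kingPr L kk r (cvM d L mv kk hL) x' - unitVec (fine (L ^ kk) (cvM d L mv kk hL)) μ → ‖f (z + unitVec (fine (L ^ r * L ^ kk) (cvM d L mv kk hL)) μ) - f z‖ ≤ b := fun z hz => hstep k μ μ z (hc1 z hz)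
  have hback : ‖f x' - f (x' - unitVec (fine (L ^ r * L ^ kk) (cvM d L mv kk hL)) μ)‖ ≤ b := by
    have h : ‖f (x' - unitVec (fine (L ^ r * L ^ kk) (cvM d L mv kk hL)) μ + unitVec (fine (L ^ r * L ^ kk) (cvM d L mv kk hL)) μ) - f (x' - unitVec (fine (L ^ r * L ^ kk) (cvM d L mv kk hL)) μ)‖ ≤ b := hstep k μ μ (x' - unitVec (fine (L ^ r * L ^ kk) (cvM d L mv kk hL)) μ) hbk
    have e0 : x' - unitVec (fine (L ^ r * L ^ kk) (cvM d L mv kk hL)) μ + unitVec (fine (L ^ r * L ^ kk) (cvM d L mv kk hL)) μ = x' := sub_add_cancel _ _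
    rw [e0] at h
    exact h
  have h1 := norm_cellOsc_le (cvM d L mv kk hL) L kk r f hb μ x' ht.le hst
  have h2 := norm_cellOsc_back_le (cvM d L mv kk hL) L kk r f hb μ x' ht.le hst hst' hback
  have eS : scShift' d L mv kk r hL μ x' = x' + unitVec (fine (L ^ r * L ^ kk) (cvM d L mv kk hL)) μ := rfl
  have eS' : scShift' d L mv kk r hL μ (x' - unitVec (fine (L ^ r * L ^ kk) (cvM d L mv kk hL)) μ) = x' - unitVec (fine (L ^ r * L ^ kk) (cvM d L mv kk hL)) μ + unitVec (fine (L ^ r * L ^ kk) (cvM d L mv kk hL)) μ := rfl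
  refine ⟨?_, ?_⟩
  · rw [eS]
    exact h1.trans hΩ1
  · rw [scShift'_symm_eq_sub, scShift_symm_eq_sub, eS']
    exact h2

end Osc

end Summit.QuantumFields.YangMills.BalabanUVNodes.N15.Gluing

end
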